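import Summits.Ventures.LatticeQCDFlow.Scaling.FlowGraphConjugacy
import Summits.Ventures.LatticeQCDFlow.Scaling.SwapGraphRateLaw

/-!
HONEST FRAMING: exact (Metropolis-corrected) sampling algorithms for lattice gauge theory; figures
of merit are autocorrelation/cost numbers at stated couplings and volumes; no continuum-physics
claim.

# FlowGraphRateLaw — THE RATE CARD WITH CONSISTENT MAPS ON ANY SWAP GRAPH: UNDER TRANSPORTED DOMINATION
# `p·μ_{k+1}(L_{k+1}⁻¹u) ≤ μ_0(u)` THE MAP-ASSISTED HOT-ONLY SCHEME OBEYS FLOOR `p·min{t·c/(6m), γ₀(1−t)/(14K)}` AND THE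
# CEILINGS `t·h·min{μ_0(A),μ_0(Aᶜ)}/(mKv)` (DILUTED HANDOVER), `t·deg(k)/(2mv)` (LEAST-CONNECTED REPLICA),
# `(1−t)Q_0(A,Aᶜ)/((K+1)v)` (TUNNELLING) — THE SAME CARD AS WITHOUT MAPS, IN LEVEL COORDINATES (lean-2 GEN-23, ours)

Venture-side (OURS).  Cell `lqcd-flow` (pub-lqcd), unit `pub-lqcd-lean-2-g23`, 2026-08-26.  Chapter K, file 11:
`Scaling/SwapGraphRateLaw` (K3) carried through the conjugacy of `Scaling/FlowGraphConjugacy` (K8).  Scheme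
`P^φ = t·ptGraphSwap μ e φ + (1−t)·prodKernel w M` on an edge list `e` of `m` entries (distinct endpoints) listing every
hub edge `(0, k+1)` at least `c ≥ 1` times, with CONSISTENT maps `φ_r = L_{l_r}⁻¹∘L_{i_r}` from level bijections `L`
normalised at the hot level (`L_0 = id`); pulled-back laws `ν_0 = μ_0`, `ν_k = μ_k∘L_k⁻¹`; a set `A` with
`ν_k(A)ν_k(Aᶜ) ≥ v > 0`.

## What is proved

* §1 **`flowGraph_spectralGap_ge`** — weights `w` with `w_0 > 0`, transported domination, hot Poincaré constant `γ₀`: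
  `Gap(P^φ) ≥ p·min{t·c/(6m), γ₀(1−t)w_0/(14K)}` (K2's multiplicity floor with maps, any graph).
* §2 **`flowGraph_rateLaw`** — hot-only updates: floor `p·min{t·c/(6m), γ₀(1−t)/(14K)}` ∧ diluted handover
  `t·h·min{μ_0(A),μ_0(Aᶜ)}/(m·K·v)` ∧ least-connected replica `t·deg(k+1)/(2m·v)` for every cold level ∧ tunnelling
  `(1−t)·Q_0(A,Aᶜ)/((K+1)·v)` with `γ₀μ_0(A)μ_0(Aᶜ) ≤ Q_0(A,Aᶜ)`.

Reading (no numerics implied): for composed-flow exchange schemes on any topology the four numbers of K3 — rarest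
hub-edge frequency, hot-degree frequency, hot tunnelling rate, number of waiting replicas — still pin the rate, with
the domination constant and the sector masses read in level coordinates; nothing else about the maps enters.  NOT
CLAIMED: inconsistent map families; cold replicas relaxing within sectors; continuous spaces; anything measured.
Literature grade (cell rule): OWN COMPOSITION (K2/K3 + K8); nothing cited as a fact; no new bib keys.
-/

noncomputable section

open Finset Function
open Literature.Probability.MarkovChains

namespace Summit.Ventures.LatticeQCDFlow.Scaling

variable {S : Type*} [Fintype S] [DecidableEq S] {K m : ℕ} {μ : Fin (K + 1) → S → ℝ}
  {M : Fin (K + 1) → S → S → ℝ} {w : Fin (K + 1) → ℝ} {t : ℝ} {e : Fin m → Fin (K + 1) × Fin (K + 1)}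

section RateLaw
variable (L : Fin (K + 1) → Equiv.Perm S)

/-! ## §1 The multiplicity floor with consistent maps -/

/-- **THE MULTIPLICITY FLOOR WITH CONSISTENT MAPS ON ANY GRAPH:** `L_0 = id`, every hub edge listed `≥ c ≥ 1` times,
weights `w ≥ 0`, `Σw = 1`, `w_0 > 0`, `0 < t < 1`, transported domination `p·μ_{k+1}(L_{k+1}⁻¹u) ≤ μ_0(u)`
(`0 < p ≤ 1`), hot Poincaré constant `γ₀`, cold updates arbitrary `μ_k`-reversible:
**`Gap(P^φ) ≥ p·min{t·c/(6m), γ₀(1−t)w_0/(14K)}`**. [ours] -/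
theorem flowGraph_spectralGap_ge [Nontrivial S] (hL0 : L 0 = Equiv.refl S) (hK : 1 ≤ K) (hm : 1 ≤ m)
    (he : ∀ r, (e r).1 ≠ (e r).2) {c : ℕ}
    (hc : ∀ k : Fin K, c ≤ (univ.filter (fun r : Fin m => e r = ((0 : Fin (K + 1)), k.succ))).card) (hc1 : 1 ≤ c)
    (hμ : ∀ k x, 0 < μ k x) (hμ1 : ∀ k, ∑ u, μ k u = 1) (hM : ∀ k, IsRowStochastic (M k))
    (hMrev : ∀ k, DetailedBalance (μ k) (M k)) (hw0 : ∀ k, 0 ≤ w k) (hw1 : ∑ k, w k = 1) (hwhot : 0 < w 0)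
    (ht0 : 0 < t) (ht1 : t < 1) {p γ₀ : ℝ} (hp : 0 < p) (hp1 : p ≤ 1) (hγ₀ : 0 < γ₀)
    (hdom : ∀ (k : Fin K) (u : S), p * μ k.succ ((L k.succ).symm u) ≤ μ 0 u)
    (hgap0 : ∀ g : S → ℝ, γ₀ * lawVariance (μ 0) g ≤ dirichletForm (μ 0) (M 0) g) :
    p * min (t * c / (6 * m)) (γ₀ * (1 - t) * w 0 / (14 * K))
      ≤ spectralGap (tensorFun μ) (fun x y : Fin (K + 1) → S =>
          t * ptGraphSwap μ e (fun r => (L (e r).1).trans (L (e r).2).symm) x y + (1 - t) * prodKernel w M x y) := by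
  rw [flowGraph_spectralGap_eq L he t w]
  have hL0u : ∀ u, (L 0).symm u = u := fun u => by rw [hL0]; rfl
  have hν0 : (fun u => μ 0 ((L 0).symm u)) = μ 0 := funext fun u => by rw [hL0u]
  have hM0 : (fun u v => M 0 ((L 0).symm u) ((L 0).symm v)) = M 0 := funext fun u => funext fun v => by rw [hL0u, hL0u]
  refine multiHub_spectralGap_ge (μ := fun i u => μ i ((L i).symm u))
    (M := fun i u v => M i ((L i).symm u) ((L i).symm v)) (e := e) hK hm he hc hc1 (fun k u => hμ k _)
    (fun k => by rw [Equiv.sum_comp (L k).symm (μ k)]; exact hμ1 k)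
    (fun k => ⟨fun u v => (hM k).1 _ _, fun u => ?_⟩) (fun k u v => hMrev k _ _) hw0 hw1 hwhot ht0 ht1 hp hp1 hγ₀
    (fun k u => ?_) ?_
  · simpa using (Equiv.sum_comp (L k).symm (fun v => M k ((L k).symm u) v)).trans ((hM k).2 _)
  · simp only [hL0u]; exact hdom k u
  · intro g
    have e1 : lawVariance (fun u => μ 0 ((L 0).symm u)) g = lawVariance (μ 0) g := by rw [hν0]
    have e2 : dirichletForm (fun u => μ 0 ((L 0).symm u)) (fun u v => M 0 ((L 0).symm u) ((L 0).symm v)) g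
        = dirichletForm (μ 0) (M 0) g := by rw [hν0, hM0]
    rw [e1, e2]; exact hgap0 g

/-! ## §2 The rate card with consistent maps -/

/-- **THE RATE CARD WITH CONSISTENT MAPS** (hot-only updates, `L_0 = id`, `K, m ≥ 1`, `|S| ≥ 2`, `0 < t < 1`,
`0 < p ≤ 1`, every hub edge listed `≥ c ≥ 1` times, transported domination, hot Poincaré constant `γ₀`, and a set `A`
with `μ_k(L_k⁻¹A)·μ_k(L_k⁻¹Aᶜ) ≥ v > 0` at every level):
**floor** `p·min{t·c/(6m), γ₀(1−t)/(14K)} ≤ Gap(P^φ)`;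
**diluted handover** `Gap(P^φ) ≤ t·h·min{μ_0(A), μ_0(Aᶜ)}/(m·K·v)`;
**least-connected replica** `Gap(P^φ) ≤ t·deg(k+1)/(2m·v)` for every cold level;
**tunnelling** `Gap(P^φ) ≤ (1−t)·Q_0(A,Aᶜ)/((K+1)·v)` and `γ₀·μ_0(A)μ_0(Aᶜ) ≤ Q_0(A,Aᶜ)`. [ours] -/
theorem flowGraph_rateLaw [Nontrivial S] (hL0 : L 0 = Equiv.refl S) (hK : 1 ≤ K) (hm : 1 ≤ m)
    (he : ∀ r, (e r).1 ≠ (e r).2) {c : ℕ}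
    (hc : ∀ k : Fin K, c ≤ (univ.filter (fun r : Fin m => e r = ((0 : Fin (K + 1)), k.succ))).card) (hc1 : 1 ≤ c)
    (hμ : ∀ k x, 0 < μ k x) (hμ1 : ∀ k, ∑ u, μ k u = 1) (hM : ∀ k, IsRowStochastic (M k))
    (hMrev : ∀ k, DetailedBalance (μ k) (M k)) (ht0 : 0 < t) (ht1 : t < 1) {p γ₀ : ℝ} (hp : 0 < p) (hp1 : p ≤ 1)
    (hγ₀ : 0 < γ₀) (hdom : ∀ (k : Fin K) (u : S), p * μ k.succ ((L k.succ).symm u) ≤ μ 0 u)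
    (hgap0 : ∀ g : S → ℝ, γ₀ * lawVariance (μ 0) g ≤ dirichletForm (μ 0) (M 0) g) {A : Finset S} {v : ℝ}
    (hvpos : 0 < v) (hv : ∀ k : Fin (K + 1), v ≤ (∑ u ∈ A, μ k ((L k).symm u)) * ∑ u ∈ Aᶜ, μ k ((L k).symm u)) :
    p * min (t * c / (6 * m)) (γ₀ * (1 - t) / (14 * K))
        ≤ spectralGap (tensorFun μ) (fun x y : Fin (K + 1) → S =>
            t * ptGraphSwap μ e (fun r => (L (e r).1).trans (L (e r).2).symm) x y
              + (1 - t) * prodKernel (fun k : Fin (K + 1) => if k = 0 then (1 : ℝ) else 0) M x y)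
      ∧ spectralGap (tensorFun μ) (fun x y : Fin (K + 1) → S =>
            t * ptGraphSwap μ e (fun r => (L (e r).1).trans (L (e r).2).symm) x y
              + (1 - t) * prodKernel (fun k : Fin (K + 1) => if k = 0 then (1 : ℝ) else 0) M x y)
          ≤ t * ((univ.filter fun r : Fin m => (e r).1 = 0 ∨ (e r).2 = 0).card : ℝ)
              * min (∑ u ∈ A, μ 0 u) (∑ u ∈ Aᶜ, μ 0 u) / (m * K * v)
      ∧ (∀ k : Fin K, spectralGap (tensorFun μ) (fun x y : Fin (K + 1) → S =>
            t * ptGraphSwap μ e (fun r => (L (e r).1).trans (L (e r).2).symm) x y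
              + (1 - t) * prodKernel (fun k : Fin (K + 1) => if k = 0 then (1 : ℝ) else 0) M x y)
          ≤ t * ((univ.filter fun r : Fin m => (e r).1 = k.succ ∨ (e r).2 = k.succ).card : ℝ) / (2 * m * v))
      ∧ (spectralGap (tensorFun μ) (fun x y : Fin (K + 1) → S =>
            t * ptGraphSwap μ e (fun r => (L (e r).1).trans (L (e r).2).symm) x y
              + (1 - t) * prodKernel (fun k : Fin (K + 1) => if k = 0 then (1 : ℝ) else 0) M x y)
          ≤ (1 - t) * edgeMeasure (μ 0) (M 0) A Aᶜ / (((K : ℝ) + 1) * v)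
        ∧ γ₀ * ((∑ u ∈ A, μ 0 u) * ∑ u ∈ Aᶜ, μ 0 u) ≤ edgeMeasure (μ 0) (M 0) A Aᶜ) := by
  rw [flowGraph_spectralGap_eq L he t]
  have hL0u : ∀ u, (L 0).symm u = u := fun u => by rw [hL0]; rfl
  have hν0 : (fun u => μ 0 ((L 0).symm u)) = μ 0 := funext fun u => by rw [hL0u]
  have hM0 : (fun u v => M 0 ((L 0).symm u) ((L 0).symm v)) = M 0 := funext fun u => funext fun v => by rw [hL0u, hL0u]
  have h := hotOnlyGraph_rateLaw (μ := fun i u => μ i ((L i).symm u))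
    (M := fun i u v => M i ((L i).symm u) ((L i).symm v)) (e := e) hK hm he hc hc1 (fun k u => hμ k _)
    (fun k => by rw [Equiv.sum_comp (L k).symm (μ k)]; exact hμ1 k)
    (fun k => ⟨fun u v => (hM k).1 _ _, fun u => by
      simpa using (Equiv.sum_comp (L k).symm (fun v => M k ((L k).symm u) v)).trans ((hM k).2 _)⟩)
    (fun k u v => hMrev k _ _) ht0 ht1 hp hp1 hγ₀ (fun k u => by simp only [hL0u]; exact hdom k u)
    (fun g => by
      have e1 : lawVariance (fun u => μ 0 ((L 0).symm u)) g = lawVariance (μ 0) g := by rw [hν0]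
      have e2 : dirichletForm (fun u => μ 0 ((L 0).symm u)) (fun u v => M 0 ((L 0).symm u) ((L 0).symm v)) g
          = dirichletForm (μ 0) (M 0) g := by rw [hν0, hM0]
      rw [e1, e2]; exact hgap0 g)
    (A := A) hvpos hv
  have hQ0 : edgeMeasure (fun u => μ 0 ((L 0).symm u)) (fun u v => M 0 ((L 0).symm u) ((L 0).symm v)) A Aᶜ
      = edgeMeasure (μ 0) (M 0) A Aᶜ := by rw [hν0, hM0]
  rw [hQ0] at h
  simp only [hL0u] at h
  exact h

end RateLaw

end Summit.Ventures.LatticeQCDFlow.Scaling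

end
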